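import Mathlib
import HarnessLib
import Summits.HodgeConjecture.HodgeConjecture.Theorems.HodgeLocusCensusSymbolicCharts

/-!
# HodgeLocusCensusSymbolicChartsA — the ENGINE-A all-λ charts of the (4,4,0) census cell: certificates, Δ-factors and the two-chart covering (cell pub-hlocus, LEAD seat ivhs-1, gen 18)
HONEST FRAMING: certified instances and evidence bearing on the general Hodge conjecture; no claim.

SETTING (record `data/ivhs/census/og81/ALLLAMBDA-A440-g18.md`, files `pub-hlocus-ivhs-1/gen18/`; companion of `HodgeLocusCensusSymbolicCharts` (ivhs-2 gen 19, engine B)).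
X_F = Fermat quartic fourfold, P, P̌ the standard pair of planes meeting in a point, δ_λ = [P] + λ[P̌], V_λ its Hodge-locus germ, N = NL(P ∪ P̌), Λ = the census complement
`smart0` (12 tilted slice monomials), n = the line direction `rand40s7`.  The lead's engine-A driver `gen18/kitjobA/symlineA.py` (taylor2 tilted-slice period kernel; the
implicit-function recursion of `taylor2.analyse` with the pivot data FIXED; exact arithmetic over ℚ(ζ₈); degree-bounded exact reconstruction from 120 + 120 integer samples,
kit j133168) produces every restricted coefficient [t_fᵃ t_nᵇ]h_β(λ) as an exact rational function P(λ)/Δ_A(λ)^k.  In each chart every coefficient with a ≤ 1 vanishes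
identically and the displayed [t_f² t_n¹] coefficient is the CERTIFICATE: at every λ₀ with Δ_A(λ₀)·cert(λ₀) ≠ 0 the generic multiplicity μ₀(λ₀) of V_{λ₀} along N is ≤ 2
(Lemma 2.3 of the lead's MU0-g16; generic-point inference of ALLLAMBDA-g17 §5, referee R88), hence = 2 with [Kloosterman 2023, Thm 1.3]
(tree: `Literature.AlgebraicGeometry.Kloosterman2025.quarticFourfold_twoPlanes_point_idealDegree_inf_lt`).
THE TWO ENGINE-A CHARTS (ζ = ζ₈, ζ⁴ = −1; engine A's own normalisation):
 chart free-3 (pivots of λ = 2, free Λ-column #3): Δ_A = (-64ζ₈³)·λ⁵(λ − ζ²);  [tf^2 tn^1] x^001001 = (3/64 + (-3/64)ζ₈²)·λ(λ+1)/(λ − ζ²)².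
 chart free-0 (same pivot rows, free Λ-column #0): Δ_A = (-32)·λ⁵(λ + ζ²);  [tf^2 tn^1] x^001001 = (-3/16 + (-3/16)ζ₈²)·λ(λ+1)/(λ + ζ²)².
(Engine B's chart with the same free column #3 has the certificate 6(ι−1)λ(λ+1)/(λ−ι)², ι = ζ² — `SymbolicCharts.cert440c1` = −128 × `certA440c3`, kernel-checked below as `certB440c1_eq_neg128_mul_certA440c3`; all nine engine-A functions of the chart are 128·(−1)^(a+b) × engine B's.)
WHAT THE KERNEL CHECKS: the four functions as `def`s over an arbitrary field of characteristic 0 with ζ⁴ = −1; non-vanishing of each off its displayed finite set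
(input: `SymbolicCharts.iota_ne_ratCast` — ζ² is irrational); the COVERING `coverA440`: for every λ ∉ {0, −1} one of the two ENGINE-A charts is valid at λ and has a non-zero
certificate (the poles ζ² and −ζ² differ in characteristic 0), so the engine-A computation alone gives μ₀(4,4,0; λ) ≤ 2 on K ∖ {0, −1}; and the vanishing of both numerators at
λ = 0 and λ = −1 (the single plane; the EXPLAINED-SMOOTH class [P] − [P̌]).
NOT FORMALISED: the computation itself (Python, exact; two engines agree up to constants), Lemma 2.3, the passage to μ₀, all Hodge theory.  Nothing here is a statement about the Hodge conjecture.
-/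

namespace Summit.HodgeConjecture.HodgeConjecture.HodgeLocus.Census.SymbolicChartsA

open Summit.HodgeConjecture.HodgeConjecture.HodgeLocus.Census.SymbolicCharts (iota_ne_ratCast)

variable {K : Type*} [Field K] [CharZero K]

/-- ζ⁴ = −1 ⇒ ζ ≠ 0. -/
theorem zeta_ne_zero {ζ : K} (hζ : ζ ^ 4 = -1) : ζ ≠ 0 := by
  intro h
  rw [h] at hζ
  norm_num at hζ

omit [CharZero K] in
/-- ζ⁴ = −1 ⇒ (ζ²)² = −1. -/
theorem zeta_sq_sq {ζ : K} (hζ : ζ ^ 4 = -1) : (ζ ^ 2) ^ 2 = -1 := by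
  rw [← pow_mul]; exact hζ

/-- in characteristic 0 the two poles differ: ζ² ≠ −ζ². -/
theorem zeta_sq_ne_neg {ζ : K} (hζ : ζ ^ 4 = -1) : ζ ^ 2 ≠ -(ζ ^ 2) := by
  intro h
  have h2 : (2 : K) * ζ ^ 2 = 0 := by linear_combination h
  rcases mul_eq_zero.mp h2 with h2 | h2
  · norm_num at h2
  · exact zeta_ne_zero hζ (pow_eq_zero_iff (n := 2) (by norm_num) |>.mp h2)

/-! ## Chart free-3 (engine A; pivots of λ = 2) -/

/-- λ-dependent part of Δ_A in chart free-3: Δ_A = (-64ζ₈³)·λ⁵(λ − ζ²). -/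
def deltaA440c3 (ζ lam : K) : K := lam ^ 5 * (lam - ζ ^ 2)

/-- the engine-A certificate of chart free-3: [tf^2 tn^1] x^001001 = (3/64 + (-3/64)ζ₈²)·λ(λ+1)/(λ−ζ²)². -/
def certA440c3 (ζ lam : K) : K := (((3 : K) / 64) + ((-3 : K) / 64) * ζ ^ 2) * lam * (lam + 1) / (lam - ζ ^ 2) ^ 2

omit [CharZero K] in
/-- Δ_A of chart free-3 is non-zero off {0, ζ²}. -/
theorem deltaA440c3_ne_zero {ζ lam : K} (h0 : lam ≠ 0) (hi : lam ≠ ζ ^ 2) : deltaA440c3 ζ lam ≠ 0 := by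
  unfold deltaA440c3
  exact mul_ne_zero (pow_ne_zero _ h0) (sub_ne_zero.mpr hi)

/-- the constant 3/64·(1 − ζ²) of the chart free-3 certificate is non-zero (ζ² is irrational). -/
theorem constA440c3_ne_zero {ζ : K} (hζ : ζ ^ 4 = -1) : (((3 : K) / 64) + ((-3 : K) / 64) * ζ ^ 2) ≠ (0 : K) := by
    intro h
    have hι := iota_ne_ratCast (K := K) (ι := ζ ^ 2) (by rw [← pow_mul]; exact hζ) (1)
    apply hι
    push_cast
    linear_combination (-64/3 : K) * h

/-- the chart free-3 certificate is non-zero off {0, −1, ζ²}. -/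
theorem certA440c3_ne_zero {ζ lam : K} (hζ : ζ ^ 4 = -1) (h0 : lam ≠ 0) (hm : lam ≠ -1) (hi : lam ≠ ζ ^ 2) :
    certA440c3 ζ lam ≠ 0 := by
  unfold certA440c3
  refine div_ne_zero ?_ (pow_ne_zero _ (sub_ne_zero.mpr hi))
  exact mul_ne_zero (mul_ne_zero (constA440c3_ne_zero hζ) h0) (fun h => hm (by linear_combination h))

/-! ## Chart free-0 (engine A; same pivot rows, free Λ-column #0) -/

/-- λ-dependent part of Δ_A in chart free-0: Δ_A = (-32)·λ⁵(λ + ζ²). -/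
def deltaA440c0 (ζ lam : K) : K := lam ^ 5 * (lam + ζ ^ 2)

/-- the engine-A certificate of chart free-0: [tf^2 tn^1] x^001001 = (-3/16 + (-3/16)ζ₈²)·λ(λ+1)/(λ+ζ²)². -/
def certA440c0 (ζ lam : K) : K := (((-3 : K) / 16) + ((-3 : K) / 16) * ζ ^ 2) * lam * (lam + 1) / (lam + ζ ^ 2) ^ 2

omit [CharZero K] in
/-- Δ_A of chart free-0 is non-zero off {0, −ζ²}. -/
theorem deltaA440c0_ne_zero {ζ lam : K} (h0 : lam ≠ 0) (hi : lam ≠ -(ζ ^ 2)) : deltaA440c0 ζ lam ≠ 0 := by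
  unfold deltaA440c0
  refine mul_ne_zero (pow_ne_zero _ h0) ?_
  intro h; exact hi (by linear_combination h)

/-- the constant −3/16·(1 + ζ²) of the chart free-0 certificate is non-zero (ζ² is irrational). -/
theorem constA440c0_ne_zero {ζ : K} (hζ : ζ ^ 4 = -1) : (((-3 : K) / 16) + ((-3 : K) / 16) * ζ ^ 2) ≠ (0 : K) := by
    intro h
    have hι := iota_ne_ratCast (K := K) (ι := ζ ^ 2) (by rw [← pow_mul]; exact hζ) (-1)
    apply hι
    push_cast
    linear_combination (-16/3 : K) * h

/-- the chart free-0 certificate is non-zero off {0, −1, −ζ²}. -/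
theorem certA440c0_ne_zero {ζ lam : K} (hζ : ζ ^ 4 = -1) (h0 : lam ≠ 0) (hm : lam ≠ -1) (hi : lam ≠ -(ζ ^ 2)) :
    certA440c0 ζ lam ≠ 0 := by
  unfold certA440c0
  refine div_ne_zero ?_ (pow_ne_zero _ ?_)
  · exact mul_ne_zero (mul_ne_zero (constA440c0_ne_zero hζ) h0) (fun h => hm (by linear_combination h))
  · intro h; exact hi (by linear_combination h)

/-! ## Covering: the two ENGINE-A charts decide every λ ∉ {0, −1} -/

/-- COVERING for (4,4,0) by engine A's charts: for every λ ∉ {0, −1} one of the two charts is valid at λ with a non-zero certificate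
(so the engine-A computation alone gives μ₀(4,4,0; λ) ≤ 2 for every λ ∈ K ∖ {0, −1}). -/
theorem coverA440 {ζ lam : K} (hζ : ζ ^ 4 = -1) (h0 : lam ≠ 0) (hm : lam ≠ -1) :
    (deltaA440c3 ζ lam ≠ 0 ∧ certA440c3 ζ lam ≠ 0) ∨ (deltaA440c0 ζ lam ≠ 0 ∧ certA440c0 ζ lam ≠ 0) := by
  by_cases hi : lam = ζ ^ 2
  · right
    have hi' : lam ≠ -(ζ ^ 2) := by rw [hi]; exact zeta_sq_ne_neg hζ
    exact ⟨deltaA440c0_ne_zero h0 hi', certA440c0_ne_zero hζ h0 hm hi'⟩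
  · left
    exact ⟨deltaA440c3_ne_zero h0 hi, certA440c3_ne_zero hζ h0 hm hi⟩

omit [CharZero K] in
/-- both charts of engine A and chart 1 of engine B (`SymbolicCharts.cover440`'s first chart, pole ι = ζ²) are simultaneously valid off {0, ζ², −ζ²}. -/
theorem chartsA_valid_iff {ζ lam : K} : (deltaA440c3 ζ lam ≠ 0 ∧ deltaA440c0 ζ lam ≠ 0) ↔ (lam ≠ 0 ∧ lam ≠ ζ ^ 2 ∧ lam ≠ -(ζ ^ 2)) := by
  unfold deltaA440c3 deltaA440c0
  constructor
  · rintro ⟨h3, h0'⟩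
    refine ⟨fun h => h3 (by rw [h]; ring), fun h => h3 (by rw [h]; ring), fun h => h0' (by rw [h]; ring)⟩
  · rintro ⟨h0, hi, hni⟩
    refine ⟨mul_ne_zero (pow_ne_zero _ h0) (sub_ne_zero.mpr hi), mul_ne_zero (pow_ne_zero _ h0) ?_⟩
    intro h; exact hni (by linear_combination h)

/-! ## The numerators vanish at the two excluded classes -/

omit [CharZero K] in
/-- the chart free-3 certificate vanishes at the two excluded values λ = 0, −1. -/
theorem certA440c3_zero_at_excluded (ζ : K) : certA440c3 ζ 0 = 0 ∧ certA440c3 ζ (-1) = 0 := by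
  unfold certA440c3; constructor <;> simp

omit [CharZero K] in
/-- the chart free-0 certificate vanishes at the two excluded values λ = 0, −1. -/
theorem certA440c0_zero_at_excluded (ζ : K) : certA440c0 ζ 0 = 0 ∧ certA440c0 ζ (-1) = 0 := by
  unfold certA440c0; constructor <;> simp

/-! ## Cross-engine identities (the same chart, free column #3, on the two kernels)
The engine-B chart 1 of `HodgeLocusCensusSymbolicCharts` (ivhs-2 gen 19, direct recursion over ℚ(ζ₈)[λ]) and the engine-A chart free-3 here
(lead gen 18, fixed-pivot interpolation, kit j133168) were reconstructed independently; their Δ-factors coincide and their certificates are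
proportional by the kernel constant −128 (record ALLLAMBDA-A440-g18 §5(a): all nine engine-A functions are 128·(−1)^(a+b) × ivhs-2's). -/

omit [CharZero K] in
/-- the λ-dependent Δ-factor of engine A's chart free-3 IS engine B's chart-1 factor (ι = ζ²). -/
theorem deltaA440c3_eq_engineB (ζ lam : K) : deltaA440c3 ζ lam = SymbolicCharts.delta440c1 (ζ ^ 2) lam := by
  unfold deltaA440c3 SymbolicCharts.delta440c1; ring

/-- engine B's chart-1 certificate = −128 × engine A's chart free-3 certificate, identically in λ (ι = ζ²; characteristic 0 for the numerals). -/
theorem certB440c1_eq_neg128_mul_certA440c3 (ζ lam : K) :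
    SymbolicCharts.cert440c1 (ζ ^ 2) lam = -128 * certA440c3 ζ lam := by
  unfold SymbolicCharts.cert440c1 certA440c3; ring

end Summit.HodgeConjecture.HodgeConjecture.HodgeLocus.Census.SymbolicChartsA
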